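import Summits.CriticalPhenomena.PercolationContinuityZ3.Theorems.PercNearOneGluingNoHeavyLowerTailQuantitativeS5IsolatedFloor
import Summits.CriticalPhenomena.PercolationContinuityZ3.Theorems.PercNearOneGluingNoHeavyLowerTailQuantitativeCshFloorLtOne
import HarnessLib

/-!
# The (S5) floors (rows M2-R6 / M2-R21) on an ARBITRARY finite weighted graph and for EVERY compatible injective rank

Support file (`--supports stmt-CriticalPhenomena-4575`), prover seat `prim-rate-mine-2` (lane prim-rate, constants-miner (c), BENCH rows
M2-R6 / M2-R21 / M2-R22 / M2-R24; `run/shared/lean/prim/prim-rate/prim-rate-mine-2/CANDIDATES.md` §gen-5).  No definitions, no named facts,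
no sorries; standard axioms.

`…QuantitativeS5IsolatedFloorClosure.lean` transported the graph-explicit (S5) floor to weights in `[0,1)` by continuity, at the price of a
STRICTLY compatible rank (ties of the relay means break under perturbation of the weights).  THIS FILE removes the restriction by re-running
prim-hp-8's peeling (verbatim the tree's `CSH.s5dMargin_ge_sum_rankGain_add_worldFloor_of_csh`) directly at weights `< 1`: the three places
where non-degeneracy entered — positivity of `μ(k ↮ T')` (the empty configuration lies in it), the quantitative Lemma AC and the world-Harris
floor of the peeled CSH margin — are supplied by `CSH.prodBernoulli_real_pos_of_empty_mem`, `CSH.avoidConst_le_cshMarg_of_lt_one` and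
`CSH.cshMargin_ge_worldHarris_of_lt_one`, and the hierarchy itself by the tree's `CSH.cshAll_of_lt_one`.  Results:
`CSH.s5dMargin_ge_sum_rankGain_add_worldFloor_of_lt_one` (row M2-R6 on arbitrary support graphs, every decoy list) and
`CSH.s5dMargin_ge_sum_rankGain_add_isolatedFloor_of_lt_one_of_compat` (row M2-R21, `D = []`, every compatible injective rank).
[cite: KozmaNitzan2024, Conj. 4 (p. 32), Lemma 2 (p. 6)] [cite: VandenbergHaggstromKahn2005, §2.1 pp. 9–13, Thm. 1.4 (p. 7)]
-/

noncomputable section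

namespace Summit.CriticalPhenomena.PercolationContinuityZ3.Theorems

open MeasureTheory Set Literature.Probability.LatticeModels Literature.Probability.Percolation
open scoped Classical
open KNPreFKG

namespace CSH

variable {n : ℕ}

/-- **Quantitative (S5D) with the world-Harris floors at weights `< 1`, from the hierarchy.**  Verbatim the tree's
`CSH.s5dMargin_ge_sum_rankGain_add_worldFloor_of_csh` with `0 < w e` dropped:
`Σ_{a ∈ T} (γ_a · μ(o ∈ C_a | a ↮ (T∖a) ∪ D ∪ {v}) + worldFloor_a) ≤ s5dMargin w T r D o v F`.
[cite: KozmaNitzan2024, Conj. 4 (p. 32), Lemma 2 (p. 6)] [cite: VandenbergHaggstromKahn2005, §2.1 pp. 9–13, Thm. 1.4 (p. 7)] -/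
theorem s5dMargin_ge_sum_rankGain_add_worldFloor_of_csh_lt_one (w : Sym2 (Fin n) → unitInterval) (hw : ∀ e, w e < 1)
    (o v : Fin n) (hov : o ≠ v)
    (hCSH : ∀ (x : Fin n) (Y : Finset (Fin n)) (D : List (Fin n)),
      x ∉ Y → o ≠ x → v ≠ x → o ∉ Y → v ∉ Y → D.Nodup → (∀ d ∈ D, d ≠ x ∧ d ∉ Y ∧ d ≠ o ∧ d ≠ v) →
      CSHHolds w x (↑Y : Set (Fin n)) D o v) :
    ∀ (T : Finset (Fin n)) (r : Fin n → ℕ) (D : List (Fin n)) (F : Set (Fin n) → ℝ),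
      (∀ S S' : Set (Fin n), S ⊆ S' → F S ≤ F S') → (∀ S : Set (Fin n), 0 ≤ F S) → Set.InjOn r ↑T →
      (∀ a ∈ T, ∀ a' ∈ T, r a < r a' →
        ∫ ω, F (openCluster ω a) ∂(prodBernoulli w) ≤ ∫ ω, F (openCluster ω a') ∂(prodBernoulli w)) →
      o ∉ T → v ∉ T → D.Nodup → (∀ d ∈ D, d ∉ T ∧ d ≠ o ∧ d ≠ v) →
      ∑ a ∈ T, (rankGain w T r F a * avoidConst w a ((↑(T.erase a) : Set (Fin n)) ∪ ({d | d ∈ D} ∪ {v})) o +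
          worldFloor w a (↑(T.filter (fun b => r b < r a)) : Set (Fin n)) (insert a (T.filter (fun b => r a < r b) ∪ D.toFinset)) o v F)
        ≤ s5dMargin w T r D o v F := by
  classical
  have main : ∀ (N : ℕ) (T : Finset (Fin n)) (r : Fin n → ℕ) (D : List (Fin n)) (F : Set (Fin n) → ℝ), T.card = N →
      (∀ S S' : Set (Fin n), S ⊆ S' → F S ≤ F S') → (∀ S : Set (Fin n), 0 ≤ F S) → Set.InjOn r ↑T →
      (∀ a ∈ T, ∀ a' ∈ T, r a < r a' →
        ∫ ω, F (openCluster ω a) ∂(prodBernoulli w) ≤ ∫ ω, F (openCluster ω a') ∂(prodBernoulli w)) →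
      o ∉ T → v ∉ T → D.Nodup → (∀ d ∈ D, d ∉ T ∧ d ≠ o ∧ d ≠ v) →
      ∑ a ∈ T, (rankGain w T r F a * avoidConst w a ((↑(T.erase a) : Set (Fin n)) ∪ ({d | d ∈ D} ∪ {v})) o +
          worldFloor w a (↑(T.filter (fun b => r b < r a)) : Set (Fin n)) (insert a (T.filter (fun b => r a < r b) ∪ D.toFinset)) o v F)
        ≤ s5dMargin w T r D o v F := by
    intro N
    induction N using Nat.strong_induction_on with
    | _ N ih =>
    intro T r D F hN hF hF0 hr hcompat hoT hvT hD hDT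
    set μ := prodBernoulli w with hμ
    have hmeas : ∀ S : Set (BondConfig (Fin n)), MeasurableSet S := fun _ => MeasurableSet.of_discrete
    have hn := fun (S : Set (BondConfig (Fin n))) => (measureReal_nonneg : 0 ≤ μ.real S)
    rcases T.eq_empty_or_nonempty with hT0 | hne
    · -- no relays: both sides vanish
      subst hT0
      have h0 : surplus w (∅ : Finset (Fin n)) r F = fun _ => 0 := by
        funext u; simp [surplus]
      rw [Finset.sum_empty, s5dMargin, h0]
      have := slForm_zero (decoyList w (↑(∅ : Finset (Fin n)) : Set (Fin n)) D)
      simp only [cshMarg]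
      rw [show (fun _ : Fin n => (0 : ℝ)) = (0 : Fin n → ℝ) from rfl, this]
      simp
    obtain ⟨k, hkT, hkmax⟩ := Finset.exists_max_image T r hne
    set T' : Finset (Fin n) := T.erase k with hT'
    have hTcard : T'.card < N := by
      have hpos : 0 < T.card := Finset.card_pos.2 hne
      rw [hT', Finset.card_erase_of_mem hkT]; omega
    have hT'T : ∀ a ∈ T', a ∈ T := fun a ha => Finset.mem_of_mem_erase ha
    have hkT' : k ∉ T' := Finset.notMem_erase k T
    have hlt : ∀ a ∈ T', r a < r k := by
      intro a ha
      rcases (hkmax a (hT'T a ha)).lt_or_eq with h | h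
      · exact h
      · exact absurd (hr (hT'T a ha) hkT h) (Finset.ne_of_mem_erase ha)
    have hrT' : Set.InjOn r ↑T' := hr.mono (by intro a ha; exact hT'T a ha)
    have hcompatT' : ∀ a ∈ T', ∀ a' ∈ T', r a < r a' →
        ∫ ω, F (openCluster ω a) ∂μ ≤ ∫ ω, F (openCluster ω a') ∂μ :=
      fun a ha a' ha' h => hcompat a (hT'T a ha) a' (hT'T a' ha') h
    have hmle : ∀ a ∈ T', ∫ ω, F (openCluster ω a) ∂μ ≤ ∫ ω, F (openCluster ω k) ∂μ :=
      fun a ha => hcompat a (hT'T a ha) k hkT (hlt a ha)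
    have hko : o ≠ k := fun h => hoT (h ▸ hkT)
    have hkv : v ≠ k := fun h => hvT (h ▸ hkT)
    have hkD : k ∉ D := fun h => (hDT k h).1 hkT
    set Dk : Set (BondConfig (Fin n)) := {ω : BondConfig (Fin n) | ∀ a ∈ (↑T' : Set (Fin n)), ¬ (openGraph ω).Reachable k a}
      with hDk
    set mk : ℝ := ∫ ω, F (openCluster ω k) ∂μ with hmk
    set κ : ℝ := mk * μ.real Dk - ∫ ω in Dk, F (openCluster ω k) ∂μ with hκ
    set L := decoyList w (↑T : Set (Fin n)) D with hL
    set p : ℝ := obsConst w o v ((↑T : Set (Fin n)) ∪ {d | d ∈ D}) with hp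
    set ck : Fin n → ℝ := avoidConst w k (↑T' : Set (Fin n)) with hck
    set Fh : Set (Sym2 (Fin n)) → ℝ := fun C => F {a | a = k ∨ ∃ e ∈ C, a ∈ e} with hFh
    set Tk : Fin n → ℝ := fun u => (∫ ω in Dk ∩ openConn k u, F (openCluster ω k) ∂μ) - μ.real (Dk ∩ openConn k u) * mk
      with hTk
    set qk : ℝ := avoidConst w k ((↑T' : Set (Fin n)) ∪ ({d | d ∈ D} ∪ {v})) o with hqk
    have hempty_Dk : (∅ : BondConfig (Fin n)) ∈ Dk := by
      intro a ha h
      rw [HullPort.reachable_empty_iff] at h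
      exact hkT' (h ▸ (Finset.mem_coe.1 ha))
    have hDkpos : 0 < μ.real Dk := prodBernoulli_real_pos_of_empty_mem w hw hempty_Dk
    have hins : insert k (↑T' : Set (Fin n)) = ↑T := by
      rw [hT', Finset.coe_erase, insert_sdiff_singleton, insert_eq_of_mem (Finset.mem_coe.2 hkT)]
    have hset2 : (↑T' : Set (Fin n)) ∪ {d | d ∈ k :: D} = (↑T : Set (Fin n)) ∪ {d | d ∈ D} := by
      ext a
      simp only [mem_union, Finset.mem_coe, hT', Finset.mem_erase, mem_setOf_eq, List.mem_cons]
      constructor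
      · rintro (⟨_, ha⟩ | rfl | ha)
        · exact Or.inl ha
        · exact Or.inl hkT
        · exact Or.inr ha
      · rintro (ha | ha)
        · by_cases hak : a = k
          · exact Or.inr (Or.inl hak)
          · exact Or.inl ⟨hak, ha⟩
        · exact Or.inr (Or.inr ha)
    have hcshMargin : ∀ f : Set (Sym2 (Fin n)) → ℝ,
        cshMargin w k (↑T' : Set (Fin n)) D o v f = cshMarg L p o v (covD w k (↑T' : Set (Fin n)) f) := by
      intro f
      rw [cshMargin, hins]
    have hnext : s5dMargin w T' r (k :: D) o v F =
        cshMarg L p o v (surplus w T' r F) - surplus w T' r F k * cshMarg L p o v ck := by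
      rw [s5dMargin, hset2, decoyList, hins, cshMarg_cons]
    -- (1) Lemma P: peel `k`
    have hpeel : surplus w T r F = (surplus w T' r F) + Tk := by
      funext u
      rw [Pi.add_apply, surplus_erase_add w T r F hkT hlt u]
    -- (2) the top-relay term through `covD`
    have hTk_cov : (μ.real Dk) • Tk = covD w k (↑T' : Set (Fin n)) Fh - (κ * μ.real Dk) • ck := by
      funext u
      simp only [Pi.smul_apply, Pi.sub_apply, smul_eq_mul]
      have h1 := covD_clusterFun_eq w T' F k u
      have h2 : μ.real (Dk ∩ openConn k u) = μ.real Dk * ck u := by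
        simp only [hck, avoidConst, hDk]
        rw [mul_div_cancel₀ _ (ne_of_gt hDkpos)]
      simp only [hTk, hFh, hκ, hmk, hDk] at h1 h2 ⊢
      rw [h1, h2]
      ring
    -- (3) CSH for the peeled relay (for Lemma AC) and its QUANTITATIVE form: the world-Harris floor of `k` survives
    have hCSHk := hCSH k T' D hkT' hko hkv (fun h => hoT (hT'T o h)) (fun h => hvT (hT'T v h)) hD
      (fun d hd => ⟨fun h => hkD (h ▸ hd), fun h => (hDT d hd).1 (hT'T d h), (hDT d hd).2.1, (hDT d hd).2.2⟩)
    have hD4 : ∀ d ∈ D, d ≠ k ∧ d ∉ (↑T' : Set (Fin n)) ∧ d ≠ o ∧ d ≠ v := fun d hd =>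
      ⟨fun h => hkD (h ▸ hd), fun h => (hDT d hd).1 (hT'T d (Finset.mem_coe.1 h)), (hDT d hd).2.1, (hDT d hd).2.2⟩
    have h3q := cshMargin_ge_worldHarris_of_lt_one w hw k (↑T' : Set (Fin n)) D o v (fun h => hkT' (Finset.mem_coe.1 h)) hko hkv
      (fun h => hoT (hT'T o (Finset.mem_coe.1 h))) (fun h => hvT (hT'T v (Finset.mem_coe.1 h))) hov hD hD4 Fh
      (monotone_clusterFun k F hF) (fun C => hF0 _)
    rw [hcshMargin] at h3q
    have hfilt_lo : T.filter (fun b => r b < r k) = T' := by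
      ext b
      simp only [Finset.mem_filter, hT', Finset.mem_erase]
      exact ⟨fun ⟨hbT, hb⟩ => ⟨fun h => (lt_irrefl (r k)) (h ▸ hb), hbT⟩, fun ⟨hbk, hbT⟩ => ⟨hbT, hlt b (Finset.mem_erase.2 ⟨hbk, hbT⟩)⟩⟩
    have hfilt_hi : T.filter (fun b => r k < r b) = ∅ := by
      ext b
      simp only [Finset.mem_filter, Finset.notMem_empty, iff_false, not_and, not_lt]
      exact fun hbT => hkmax b hbT
    have h3' : μ.real Dk * worldFloor w k (↑(T.filter (fun b => r b < r k)) : Set (Fin n))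
        (insert k (T.filter (fun b => r k < r b) ∪ D.toFinset)) o v F ≤ cshMarg L p o v (covD w k (↑T' : Set (Fin n)) Fh) := by
      rw [hfilt_lo, hfilt_hi, Finset.empty_union, worldFloor]
      convert h3q using 20  -- `DecidableEq (Fin n)` in `List.toFinset`: the instance vs the classical one of the general-`V` lemma
    -- (4) QUANTITATIVE Lemma AC: `Marg[c_k] ≥ q_k`
    have h4 : qk ≤ cshMarg L p o v ck := by
      have h := avoidConst_le_cshMarg_of_lt_one w hw k (↑T' : Set (Fin n)) D o v (fun h => hkT' (Finset.mem_coe.1 h)) hkD hkv.symm hCSHk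
      rw [hins] at h
      simpa only [hqk, hck, hL, hp] using h
    -- (5) Lemma κ with its slack: `Sur_k(T') − κ = γ_k ≥ 0`
    have h5 : surplus w T' r F k - κ = rankGain w T r F k := by
      rw [rankGain_top_eq w T r F k hkT hr hkmax]
    have hγk : 0 ≤ rankGain w T r F k :=
      rankGain_nonneg w T r F k (fun a' ha' hlt' => hcompat a' ha' k hkT hlt')
    -- (6) the next rung by induction (WITH its gains)
    have h6 : ∑ a ∈ T', (rankGain w T' r F a * avoidConst w a ((↑(T'.erase a) : Set (Fin n)) ∪ ({d | d ∈ k :: D} ∪ {v})) o +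
          worldFloor w a (↑(T'.filter (fun b => r b < r a)) : Set (Fin n)) (insert a (T'.filter (fun b => r a < r b) ∪ (k :: D).toFinset)) o v F)
        ≤ s5dMargin w T' r (k :: D) o v F :=
      ih T'.card hTcard T' r (k :: D) F rfl hF hF0 hrT' hcompatT' (fun h => hoT (hT'T o h)) (fun h => hvT (hT'T v h))
        (List.nodup_cons.2 ⟨hkD, hD⟩)
        (fun d hd => by
          rcases List.mem_cons.1 hd with rfl | hd
          · exact ⟨hkT', hko.symm, hkv.symm⟩
          · exact ⟨fun h => (hDT d hd).1 (hT'T d h), (hDT d hd).2.1, (hDT d hd).2.2⟩)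
    -- (6b) the induction sum is the `T'`-part of the target sum
    have hsumT' : ∑ a ∈ T', (rankGain w T' r F a * avoidConst w a ((↑(T'.erase a) : Set (Fin n)) ∪ ({d | d ∈ k :: D} ∪ {v})) o +
          worldFloor w a (↑(T'.filter (fun b => r b < r a)) : Set (Fin n)) (insert a (T'.filter (fun b => r a < r b) ∪ (k :: D).toFinset)) o v F)
        = ∑ a ∈ T', (rankGain w T r F a * avoidConst w a ((↑(T.erase a) : Set (Fin n)) ∪ ({d | d ∈ D} ∪ {v})) o +
          worldFloor w a (↑(T.filter (fun b => r b < r a)) : Set (Fin n)) (insert a (T.filter (fun b => r a < r b) ∪ D.toFinset)) o v F) := by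
      refine Finset.sum_congr rfl fun a ha => ?_
      have hak : a ≠ k := Finset.ne_of_mem_erase ha
      have hak' : r a < r k := hlt a ha
      have hf1 : T'.filter (fun b => r b < r a) = T.filter (fun b => r b < r a) := by
        ext b
        simp only [Finset.mem_filter, hT', Finset.mem_erase]
        exact ⟨fun ⟨⟨_, hbT⟩, hb⟩ => ⟨hbT, hb⟩, fun ⟨hbT, hb⟩ => ⟨⟨fun h => lt_asymm hak' (h ▸ hb), hbT⟩, hb⟩⟩
      have hf2 : T'.filter (fun b => r a < r b) ∪ (k :: D).toFinset = T.filter (fun b => r a < r b) ∪ D.toFinset := by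
        ext b
        simp only [Finset.mem_union, Finset.mem_filter, hT', Finset.mem_erase, List.toFinset_cons, Finset.mem_insert, List.mem_toFinset]
        constructor
        · rintro (⟨⟨_, hbT⟩, hb⟩ | rfl | hbD)
          · exact Or.inl ⟨hbT, hb⟩
          · exact Or.inl ⟨hkT, hak'⟩
          · exact Or.inr hbD
        · rintro (⟨hbT, hb⟩ | hbD)
          · by_cases hbk : b = k
            · exact Or.inr (Or.inl hbk)
            · exact Or.inl ⟨⟨hbk, hbT⟩, hb⟩
          · exact Or.inr (Or.inr hbD)
      rw [hf1, hf2]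
      have hset : (↑(T'.erase a) : Set (Fin n)) ∪ ({d | d ∈ k :: D} ∪ {v}) = (↑(T.erase a) : Set (Fin n)) ∪ ({d | d ∈ D} ∪ {v}) := by
        ext b
        simp only [mem_union, Finset.mem_coe, hT', Finset.mem_erase, mem_setOf_eq, List.mem_cons, mem_singleton_iff]
        constructor
        · rintro (⟨hba, _, hbT⟩ | (rfl | hbD) | hbv)
          · exact Or.inl ⟨hba, hbT⟩
          · exact Or.inl ⟨hak.symm, hkT⟩
          · exact Or.inr (Or.inl hbD)
          · exact Or.inr (Or.inr hbv)
        · rintro (⟨hba, hbT⟩ | hbD | hbv)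
          · by_cases hbk : b = k
            · exact Or.inr (Or.inl (Or.inl hbk))
            · exact Or.inl ⟨hba, hbk, hbT⟩
          · exact Or.inr (Or.inl (Or.inr hbD))
          · exact Or.inr (Or.inr hbv)
      rw [rankGain_erase_top w T r F k a ha hkmax hr hkT, hset]
    have hqk' : avoidConst w k ((↑(T.erase k) : Set (Fin n)) ∪ ({d | d ∈ D} ∪ {v})) o = qk := by rfl
    -- (7) assemble: `μ(Dk)·M(T;D) = μ(Dk)·M(T';k::D) + CSH-term + γ_k·μ(Dk)·Marg[c_k]`
    have hmain : μ.real Dk * s5dMargin w T r D o v F =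
        μ.real Dk * cshMarg L p o v (surplus w T' r F) + cshMarg L p o v (covD w k (↑T' : Set (Fin n)) Fh) -
          κ * μ.real Dk * cshMarg L p o v ck := by
      have e1 : μ.real Dk * cshMarg L p o v Tk =
          cshMarg L p o v (covD w k (↑T' : Set (Fin n)) Fh) - κ * μ.real Dk * cshMarg L p o v ck := by
        rw [← cshMarg_smul, hTk_cov, cshMarg_sub, cshMarg_smul]
      rw [s5dMargin, ← hL, ← hp, hpeel, cshMarg_add, mul_add, e1]
      ring
    have hkey : μ.real Dk * s5dMargin w T r D o v F =
        μ.real Dk * s5dMargin w T' r (k :: D) o v F + cshMarg L p o v (covD w k (↑T' : Set (Fin n)) Fh) +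
          rankGain w T r F k * μ.real Dk * cshMarg L p o v ck := by
      rw [hmain, hnext, ← h5]
      ring
    have hgain : rankGain w T r F k * μ.real Dk * qk ≤ rankGain w T r F k * μ.real Dk * cshMarg L p o v ck :=
      mul_le_mul_of_nonneg_left h4 (mul_nonneg hγk hDkpos.le)
    have hbound : μ.real Dk * (∑ a ∈ T, (rankGain w T r F a * avoidConst w a ((↑(T.erase a) : Set (Fin n)) ∪ ({d | d ∈ D} ∪ {v})) o +
          worldFloor w a (↑(T.filter (fun b => r b < r a)) : Set (Fin n)) (insert a (T.filter (fun b => r a < r b) ∪ D.toFinset)) o v F))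
        ≤ μ.real Dk * s5dMargin w T r D o v F := by
      rw [← Finset.add_sum_erase T _ hkT, ← hT', ← hsumT', hqk', mul_add, hkey]
      have := mul_le_mul_of_nonneg_left h6 hDkpos.le
      nlinarith [h3', hgain, this, hDkpos.le]
    exact le_of_mul_le_mul_left hbound hDkpos
  intro T r D F hF hF0 hr hcompat hoT hvT hD hDT
  exact main T.card T r D F rfl hF hF0 hr hcompat hoT hvT hD hDT


/-- **Row M2-R6 on an arbitrary finite weighted graph** (all weights `< 1`, every decoy list, every compatible injective rank): the
hierarchy for weights in `[0,1)` is the tree's `CSH.cshAll_of_lt_one`. [cite: KozmaNitzan2024, Conj. 4 (p. 32)] -/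
theorem s5dMargin_ge_sum_rankGain_add_worldFloor_of_lt_one (w : Sym2 (Fin n) → unitInterval) (hw : ∀ e, w e < 1) (o v : Fin n)
    (hov : o ≠ v) (T : Finset (Fin n)) (r : Fin n → ℕ) (D : List (Fin n)) (F : Set (Fin n) → ℝ)
    (hF : ∀ S S' : Set (Fin n), S ⊆ S' → F S ≤ F S') (hF0 : ∀ S : Set (Fin n), 0 ≤ F S) (hr : Set.InjOn r ↑T)
    (hcompat : ∀ a ∈ T, ∀ a' ∈ T, r a < r a' →
      ∫ ω, F (openCluster ω a) ∂(prodBernoulli w) ≤ ∫ ω, F (openCluster ω a') ∂(prodBernoulli w))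
    (hoT : o ∉ T) (hvT : v ∉ T) (hD : D.Nodup) (hDT : ∀ d ∈ D, d ∉ T ∧ d ≠ o ∧ d ≠ v) :
    ∑ a ∈ T, (rankGain w T r F a * avoidConst w a ((↑(T.erase a) : Set (Fin n)) ∪ ({d | d ∈ D} ∪ {v})) o +
        worldFloor w a (↑(T.filter (fun b => r b < r a)) : Set (Fin n)) (insert a (T.filter (fun b => r a < r b) ∪ D.toFinset)) o v F)
      ≤ s5dMargin w T r D o v F :=
  s5dMargin_ge_sum_rankGain_add_worldFloor_of_csh_lt_one w hw o v hov
    (fun x Y D' hxY hox hvx hoY hvY hD' hdis => cshAll_of_lt_one n w hw o v x Y D' hov hxY hox hvx hoY hvY hD' hdis) T r D F hF hF0 hr hcompat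
    hoT hvT hD hDT

/-- **Row M2-R21 on an arbitrary finite weighted graph, EVERY compatible injective rank** (`D = []`, all weights `< 1`, `F` monotone
nonnegative, `o ≠ v` off `T`): `Σ_{a∈T} ( γ_a·q_a + ∏_{e ∩ T_{<a} ≠ ∅}(1 − w_e) · Cov_{w_{T<a}}(F(Ĉ_a), 1{o ↔ {a} ∪ T_{>a} ∨ o ↔ v}) ) ≤
s5dMargin w T r [] o v F` — the strict-rank hypothesis of `…_isolatedFloor_of_lt_one` removed. [cite: KozmaNitzan2024, Conj. 4 (p. 32)]
[cite: VandenbergHaggstromKahn2005, §2.1 (pp. 9–13)] -/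
theorem s5dMargin_ge_sum_rankGain_add_isolatedFloor_of_lt_one_of_compat (w : Sym2 (Fin n) → unitInterval) (hw : ∀ e, w e < 1)
    (o v : Fin n) (hov : o ≠ v) (T : Finset (Fin n)) (r : Fin n → ℕ) (F : Set (Fin n) → ℝ)
    (hF : ∀ S S' : Set (Fin n), S ⊆ S' → F S ≤ F S') (hF0 : ∀ S : Set (Fin n), 0 ≤ F S) (hr : Set.InjOn r ↑T)
    (hcompat : ∀ a ∈ T, ∀ a' ∈ T, r a < r a' →
      ∫ ω, F (openCluster ω a) ∂(prodBernoulli w) ≤ ∫ ω, F (openCluster ω a') ∂(prodBernoulli w))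
    (hoT : o ∉ T) (hvT : v ∉ T) :
    ∑ a ∈ T, (rankGain w T r F a * avoidConst w a ((↑(T.erase a) : Set (Fin n)) ∪ ({d | d ∈ ([] : List (Fin n))} ∪ {v})) o +
        (∏ e ∈ Finset.univ.filter (fun e : Sym2 (Fin n) => ∃ y ∈ (↑(T.filter (fun b => r b < r a)) : Set (Fin n)), y ∈ e), (1 - (w e : ℝ))) *
          ((∫ η in ((⋃ t ∈ (insert a (T.filter (fun b => r a < r b) ∪ ([] : List (Fin n)).toFinset)), openConn o t) ∪ openConn o v),
              F {c | c = a ∨ ∃ e ∈ openEdgeCluster η a, c ∈ e}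
              ∂(prodBernoulli fun e => if (∃ y ∈ (↑(T.filter (fun b => r b < r a)) : Set (Fin n)), y ∈ e) then (0 : unitInterval) else w e)) -
            (prodBernoulli fun e => if (∃ y ∈ (↑(T.filter (fun b => r b < r a)) : Set (Fin n)), y ∈ e) then (0 : unitInterval) else w e).real
                ((⋃ t ∈ (insert a (T.filter (fun b => r a < r b) ∪ ([] : List (Fin n)).toFinset)), openConn o t) ∪ openConn o v) *
              (∫ η, F {c | c = a ∨ ∃ e ∈ openEdgeCluster η a, c ∈ e}
                ∂(prodBernoulli fun e => if (∃ y ∈ (↑(T.filter (fun b => r b < r a)) : Set (Fin n)), y ∈ e) then (0 : unitInterval) else w e))))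
      ≤ s5dMargin w T r [] o v F := by
  have hR6 := s5dMargin_ge_sum_rankGain_add_worldFloor_of_lt_one w hw o v hov T r [] F hF hF0 hr hcompat hoT hvT List.nodup_nil
    (fun d hd => by simp at hd)
  refine le_trans (Finset.sum_le_sum fun a ha => ?_) hR6
  have haY : a ∉ (↑(T.filter (fun b => r b < r a)) : Set (Fin n)) := by
    rw [Finset.coe_filter]; exact fun h => lt_irrefl _ h.2
  have h := isolated_harris_le_worldFloor w a (↑(T.filter (fun b => r b < r a)) : Set (Fin n)) haY
    (insert a (T.filter (fun b => r a < r b) ∪ ([] : List (Fin n)).toFinset)) o v F hF hF0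
  refine add_le_add le_rfl (Eq.trans_le ?_ h)
  congr! 20

end CSH

end Summit.CriticalPhenomena.PercolationContinuityZ3.Theorems
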